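import Mathlib
import Literature.Computability.Complexity.RangeAvoidance
import Literature.Computability.Complexity.SignDegreeXor
import Literature.Computability.Complexity.CookBridges
import Literature.Computability.Complexity.CodeFPLists
import Literature.Computability.Complexity.MurrayWilliams2018Protocol
import Summits.PneNP.PneNP.Theorems.LocalMapDecodeFP
import Summits.PneNP.PneNP.Theorems.PstarIsolation
import Summits.PneNP.PneNP.Theorems.PstarIsolationBound

/-!
# Isolation of the all-ones range point of a pure `P⋆` local map — the FP rung F-N3(ψ) (K3)

FRONTIER range-avoidance ladder (cell `pnp-ideate`, ROUND-19, mechanism M19; restricted-model algorithmics — nothing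
here bears on `P` vs `NP`).

By `PstarIsolationBound.isolationTheorem`, for a pure `P⋆` map that is `PseudoRandom (1/50) 2` with `m ≥ 900 n` the
string `0·1^{m−1}` (the Hamming neighbour `1ᵐ ⊕ e_0` of `C(1ⁿ) = 1ᵐ`) is outside the range.  The string function
`isoStr w = 0 · 1^{hdrM w}` reads `m` off the instance code (`LocalMapDecodeFP.hdrM`; `1ᵏ` by `MWProtocol.onesC`) and is a `CodeFP` program, hence
`IsPolyTime`; this gives the rung

  `pstarPseudoRandom_localAvoidLinearFP : LocalAvoidLinearFP 4 PseudoRandomPstar`, `C = 900`: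

range avoidance at linear stretch is in FP for the pure `P⋆` maps whose XOR graph, AND graph and XOR–AND co-occurrence
graph are spectrally pseudo-random — the random-looking regime of the roof `PstarIsolation.PstarAvoidLinearFP` (OPEN).
-/

set_option linter.dupNamespace false

open Literature.Computability.Complexity
open Summit.PneNP.PneNP.Theorems.PstarIsolation
open Summit.PneNP.PneNP.Theorems.PstarIsolationBound
open Summit.PneNP.PneNP.Theorems.LocalMapDecodeFP (hdrM hdrM_encode codeFP_hdrM)

namespace Summit.PneNP.PneNP.Theorems.PstarIsolationFP

variable {n m : ℕ}

/-- The structural promise of rung F-N3(ψ): pure `P⋆` and spectrally pseudo-random. -/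
def PseudoRandomPstar : ∀ ⦃n m : ℕ⦄, LocalMap 4 n m → Prop :=
  fun _ _ I => I.IsPure xorAndPred ∧ PseudoRandom (1 / 50) 2 I

/-- **Rung F-N3(ψ)** (statement): range avoidance in `FP` at linear stretch for pseudo-random pure `P⋆` maps. -/
def PstarPseudoRandomAvoidLinearFP : Prop := LocalAvoidLinearFP 4 PseudoRandomPstar

/-- **The avoider**: `w ↦ 0 · 1^{hdrM w}` (only the number of outputs is read off the code). -/
def isoStr (w : List Bool) : List Bool := false :: List.replicate (hdrM w) true

section PolyTime

open CodeFP

/-- Prepending the bit `0` is polynomial time. -/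
theorem codeFP_consFalse : CodeFP strE strE (List.cons false) := ⟨List.cons false, cons_mem_FP false, fun _ => rfl⟩

/-- **The avoider is a `CodeFP` program.** -/
theorem codeFP_isoStr : CodeFP strE strE isoStr :=
  (codeFP_consFalse.comp (MWProtocol.onesC.comp codeFP_hdrM)).congr fun _ => rfl

/-- **`isoStr` is polynomial-time computable** (`IsPolyTime`). -/
theorem isPolyTime_isoStr : IsPolyTime isoStr := by
  obtain ⟨f, hf, hfw⟩ := codeFP_isoStr
  have h : f = isoStr := funext fun w => hfw w
  rw [h] at hf
  exact (CookBridges.isPolyTime_iff _).2 hf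

end PolyTime

/-- The printed string reads out as the neighbour `1ᵐ ⊕ e_0`. -/
theorem readOut_isoStr (I : LocalMap 4 n m) (hm : 0 < m) :
    readOut m (isoStr I.encode) = onesFlip ⟨0, hm⟩ := by
  funext j
  unfold isoStr readOut
  rw [hdrM_encode]
  by_cases hj : j = ⟨0, hm⟩
  · subst hj
    simp [onesFlip]
  · have hj' : j.val ≠ 0 := fun h => hj (Fin.ext h)
    obtain ⟨p, hp⟩ := Nat.exists_eq_succ_of_ne_zero hj'
    have hpm : p < m := by have := j.isLt; omega
    rw [hp, List.getD_cons_succ, List.getD_eq_getElem _ _ (by simpa using hpm), List.getElem_replicate]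
    unfold onesFlip
    rw [Function.update_of_ne hj]

/-- **Rung F-N3(ψ)**: range avoidance at linear stretch `m ≥ 900 n` is in FP — by the ONE polynomial-time function
`isoStr` — for the pure `P⋆` maps that are `PseudoRandom (1/50) 2`.  Restricted-model algorithmic rung of the
range-avoidance ladder (cell pnp-ideate, ROUND-19); it says nothing about `P` versus `NP`. -/
theorem pstarPseudoRandom_localAvoidLinearFP : PstarPseudoRandomAvoidLinearFP := by
  refine ⟨900, isoStr, isPolyTime_isoStr, fun n m I hQ hn hm => ?_⟩
  have hm0 : 0 < m := lt_of_lt_of_le (by omega) hm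
  rw [readOut_isoStr I hm0]
  exact allOnesIsolated_of_pseudoRandom I hQ.1 hQ.2 hn hm ⟨0, hm0⟩

/-- **K3** — the isolation theorem gives the rung (trivially, since the rung is now a theorem). -/
theorem isolationRung : IsolationTheorem → PstarPseudoRandomAvoidLinearFP := fun _ => pstarPseudoRandom_localAvoidLinearFP

end Summit.PneNP.PneNP.Theorems.PstarIsolationFP
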